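import Literature.NumberTheory.EllipticCurves.PadicSigmaConstantFormulaProofs
import Literature.NumberTheory.EllipticCurves.PadicWeierstrassZetaProofs
import HarnessLib

/-!
# `ω = Σ_m [x^{2m}](f(x)^m) z^{2m} dz`, `w_{N-1} = H_N`, and the Mazur–Tate constant as the
# `p`-adic limit of `-[x^{pⁿ-2}]f^{(pⁿ-1)/2} / [x^{pⁿ-1}]f^{(pⁿ-1)/2}` (proofs only)

Trunk T-NT-EC (Literature/NumberTheory/EllipticCurves). Pure proof file, sequel of
`PadicSigmaConstantFormulaProofs.lean` (`c·H_N + J_N ≡ 0 (mod N)` for the constant `c` of a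
Mazur–Tate sigma pair, `H_N = [x^{N-1}]f^m`, `J_N = [x^{N-2}]f^m`, `N = 2m + 1`,
`f = x³ + a₂x² + a₄x + a₆`, under `w_{N-1} ∈ ℤ_pˣ`) and of `PadicWeierstrassZetaProofs.lean`
(Blakestad–Grant 2023, Thm. 2, with the residue lemma `res(y xᵇ ω) = 0` and the units
`w_{pⁿ-1}`):

* `coeff_two_mul_formalInvDiff` — **the invariant differential of `y² = f(x)` is
  `ω = Σ_{m ≥ 0} [x^{2m}](f(x)^m) · z^{2m} dz`** (`z = -x/y`; any additively torsion-free ring,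
  `a₁ = a₃ = 0`): from `z^{6m}f(x)^m = X^{2m}` (`X = z²x`, the Weierstrass equation) and
  `res(y xᵇ ω) = 0`. In particular **`w_{N-1} = H_N = [x^{N-1}] f^{(N-1)/2}`** for odd `N`, which
  is Blakestad–Grant's "`H` and `H₁ = w_{p-1}` are the same" (Remark after Prop. 3, citing [SB])
  and "`w_{pⁿ-1} = H_n`" (proof of Lemma 4) — with `H_n` explicit; and
  `coeff_formalInvDiff_eq_zero_of_odd'` (`ω` is even);
* over `ℚ_p` (`p ≥ 3`), for a `p`-integral model with `a₁ = a₃ = 0` and unit Hasse coefficient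
  `‖w_{p-1}‖ = 1` (good ORDINARY reduction): `norm_coeff_rhsCubic_pow_eq_one` —
  `‖[x^{pⁿ⁺¹-1}] f^{(pⁿ⁺¹-1)/2}‖ = 1`; and for a Mazur–Tate sigma pair `(σ, c)`
  (`IsMazurTateSigmaPair`, Mazur–Stein–Tate 2006 Thm. 1.3):
  `IsMazurTateSigmaPair.norm_const_add_div_le` —
  **`‖c + [x^{pⁿ⁺¹-2}]f^m / [x^{pⁿ⁺¹-1}]f^m‖ ≤ p^{-(n+1)}`** (`m = (pⁿ⁺¹-1)/2`), and
  `IsMazurTateSigmaPair.tendsto_neg_coeff_div_coeff` — **the Mazur–Tate constant is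
  `c = -lim_n [x^{pⁿ-2}]f^{(pⁿ-1)/2} / [x^{pⁿ-1}]f^{(pⁿ-1)/2}`** (so
  `E₂(E, ω) = a₁² + 4a₂ - 12c`, Mazur–Stein–Tate 2006 (1.7), is computed by the same limit);
* `coeff_mul_sub_coeff_mem_of_dvd` — the same congruence `H_N β - J_N ∈ N·R` for
  Blakestad–Grant's constant `β` in the formulation of `PadicWeierstrassZetaProofs.lean`
  (`(x - β)ω` formally exact).

## Sources

* C. Blakestad, D. Grant, J. Number Theory 249 (2023) (arXiv:1903.02480), §2.1: Prop. 3 and the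
  Remark after it (`H`, `H₁`, `w_{p-1}`; [Has], [SB] p. 271), Lemma 4 ("The residue is
  `w_{pⁿ-1} - H_n`, so `w_{pⁿ-1} = H_n`"), Thm. 2 (proof: `β = lim β_n`, `β_n = J_n/H_n`).
  [BlakestadGrant2023]
* B. Mazur, W. Stein, J. Tate, Doc. Math. Extra Vol. Coates (2006), Thm. 1.3, (1.7), §4.1 (`37a`,
  `p = 5`: the limit is `1 + 5 + 4·5² + ⋯ = E₂(E,ω)/12 = -c`). [MazurSteinTate2006]
* J. H. Silverman, *AEC* 2nd ed. (2009), IV.1, V.4.1(a) (the coefficient of `x^{q-1}` in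
  `f^{(q-1)/2}`).

Pure proof file: no definitions, no named facts.
-/

noncomputable section

open PowerSeries Filter Literature.NumberTheory.EllipticCurves
open scoped Topology

namespace WeierstrassCurve

section Ring

variable {R : Type*} [CommRing R] (W : WeierstrassCurve R) [W.IsCharNeTwoNF]

/-- **`ω/dz = Σ_m [x^{2m}](f(x)^m) z^{2m}`: the even coefficients of the invariant differential of
`y² = f(x) = x³ + a₂x² + a₄x + a₆`** (over an additively torsion-free ring): `w_{2m} = [x^{2m}] f^m`.
Proof: `z^{6m} f(x)^m = X^{2m}` (`clearedEval_pow_rhsCubic`), so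
`ω/dz = Σ_j [xʲ]f^m · z^{2(3m-j)} X^{j-2m} · ω/dz`; the term `j = 2m` contributes `[x^{2m}]f^m`
to the coefficient of `z^{2m}`, the terms `j < 2m` nothing, and the terms `j > 2m` nothing by
`res(y x^b ω) = 0` (`coeff_formalXMulSq_pow_mul_formalInvDiff`). [Blakestad–Grant 2023, Remark
after Prop. 3 ("`H` and `H₁` are the same (see the general formula for `w_n` on p. 271 of
[SB])"), Lemma 4 (`w_{pⁿ-1} = H_n`); Silverman AEC V.4.1(a)] [cite: BlakestadGrant2023, Prop. 3] -/
theorem coeff_two_mul_formalInvDiff [IsAddTorsionFree R] (m : ℕ) :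
    coeff (2 * m) W.formalInvDiff = (W.rhsCubic ^ m).coeff (2 * m) := by
  have hdeg : (W.rhsCubic ^ m).natDegree ≤ 3 * m :=
    Polynomial.natDegree_pow_le.trans (by have := W.natDegree_rhsCubic_le; nlinarith)
  have key := W.clearedEval_pow_rhsCubic m
  rw [W.clearedEval_eq_sum hdeg] at key
  set Xs := W.formalXMulSq
  set B := W.formalWDivCube
  set Wd := W.formalInvDiff
  have hBX : B * Xs = 1 := W.formalWDivCube_mul_formalXMulSq
  have hBXpow : ∀ k, Xs ^ k * B ^ k = 1 := fun k => by rw [← mul_pow, mul_comm, hBX, one_pow]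
  have h := congrArg (fun F => coeff (2 * m) (F * (B ^ (2 * m) * Wd))) key
  simp only [Finset.sum_mul, map_sum] at h
  rw [← mul_assoc, hBXpow, one_mul] at h
  rw [← h, Finset.sum_eq_single_of_mem (2 * m) (Finset.mem_range.mpr (by omega))]
  · -- the term `j = 2m`
    rw [Nat.sub_eq_of_eq_add (show 3 * m = m + 2 * m by ring),
      show C ((W.rhsCubic ^ m).coeff (2 * m)) * (Xs ^ (2 * m) * X ^ (2 * m)) * (B ^ (2 * m) * Wd) =
        C ((W.rhsCubic ^ m).coeff (2 * m)) * (X ^ (2 * m) * ((Xs ^ (2 * m) * B ^ (2 * m)) * Wd)) by ring,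
      hBXpow, one_mul, coeff_C_mul, coeff_X_pow_mul', if_pos le_rfl, Nat.sub_self,
      coeff_zero_eq_constantCoeff, constantCoeff_formalInvDiff, mul_one]
  · intro j hj hjm
    have hj' : j ≤ 3 * m := Nat.lt_succ_iff.mp (Finset.mem_range.mp hj)
    rw [show C ((W.rhsCubic ^ m).coeff j) * (Xs ^ j * X ^ (2 * (3 * m - j))) * (B ^ (2 * m) * Wd) =
        C ((W.rhsCubic ^ m).coeff j) * (X ^ (2 * (3 * m - j)) * (Xs ^ j * B ^ (2 * m) * Wd)) by ring,
      coeff_C_mul, coeff_X_pow_mul']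
    rcases Nat.lt_or_gt_of_ne hjm with hlt | hgt
    · -- `j < 2m`: the power of `z` is too large
      rw [if_neg (by omega), mul_zero]
    · -- `j > 2m`: the residue of `y x^b ω` vanishes
      obtain ⟨b, rfl⟩ : ∃ b, j = 2 * m + (b + 1) := ⟨j - 2 * m - 1, by omega⟩
      rw [if_pos (by omega), show 2 * m - 2 * (3 * m - (2 * m + (b + 1))) = 2 * b + 2 by omega,
        pow_add, show Xs ^ (2 * m) * Xs ^ (b + 1) * B ^ (2 * m) * Wd =
          (Xs ^ (2 * m) * B ^ (2 * m)) * (Xs ^ (b + 1) * Wd) by ring, hBXpow, one_mul,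
        W.coeff_formalXMulSq_pow_mul_formalInvDiff, mul_zero]

/-- The odd coefficients of `ω/dz` vanish (`ω` is even for `a₁ = a₃ = 0`). [Blakestad–Grant 2023,
proof of Prop. 3(c)] [folklore] -/
theorem coeff_formalInvDiff_eq_zero_of_odd' [IsAddTorsionFree R] {n : ℕ} (hn : Odd n) :
    coeff n W.formalInvDiff = 0 :=
  coeff_eq_zero_of_rescale_neg_one_eq_self W.rescale_neg_one_formalInvDiff hn

/-- **`ω/dz = Σ_m [x^{2m}](f^m) z^{2m}`**, all coefficients at once. [Blakestad–Grant 2023, Remark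
after Prop. 3; Silverman AEC V.4.1(a)] [folklore] -/
theorem coeff_formalInvDiff_eq [IsAddTorsionFree R] (n : ℕ) :
    coeff n W.formalInvDiff = if Even n then (W.rhsCubic ^ (n / 2)).coeff n else 0 := by
  split_ifs with h
  · obtain ⟨m, rfl⟩ := h
    rw [← two_mul, W.coeff_two_mul_formalInvDiff, Nat.mul_div_cancel_left _ two_pos]
  · exact W.coeff_formalInvDiff_eq_zero_of_odd' (Nat.not_even_iff_odd.mp h)

/-- **`H_N·β ≡ J_N (mod N)` for Blakestad–Grant's constant `β`** in the formulation of
`PadicWeierstrassZetaProofs.lean` (`(x - β)ω` formally exact: `k ∣ [z^{k+1}]((X - βz²)W)`):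
`[x^{N-1}]f^m · β - [x^{N-2}]f^m ∈ N·R` for `N = 2m + 1 ≥ 3` with `w_{N-1} ∈ Rˣ`. So their
`β = lim β_n` is `lim [x^{pⁿ-2}]f^{(pⁿ-1)/2}/[x^{pⁿ-1}]f^{(pⁿ-1)/2}`. [Blakestad–Grant 2023, Thm. 2
(proof)] [cite: BlakestadGrant2023, Thm. 2] -/
theorem coeff_mul_sub_coeff_mem_of_dvd [IsAddTorsionFree R] {m : ℕ} (hm : 1 ≤ m)
    (hw : IsUnit (coeff (2 * m) W.formalInvDiff)) {β : R}
    (h : ∀ k : ℕ, (k : R) ∣ coeff (k + 1) ((W.formalXMulSq - C β * X ^ 2) * W.formalInvDiff)) :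
    (W.rhsCubic ^ m).coeff (2 * m) * β - (W.rhsCubic ^ m).coeff (2 * m - 1) ∈
      Ideal.span {(2 * (m : R) + 1)} := by
  obtain ⟨Λ, -, -, hΛ⟩ := W.exists_padicWeierstrassZetaSeries h
  refine W.coeff_mul_sub_coeff_mem_of_clearedDeriv hm hw (Λ := Λ) ?_
  rw [clearedDeriv_def, Nat.cast_one, one_mul, hΛ]
  ring

end Ring

/-! ### Over `ℚ_p` at an ordinary prime -/

section Padic

variable {p : ℕ} [Fact p.Prime] (W : WeierstrassCurve ℚ_[p]) [W.IsCharNeTwoNF] [W.IsIntegral ℤ_[p]]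

/-- An odd prime power `pⁿ⁺¹` is `2m + 1` with `m = (pⁿ⁺¹ - 1)/2 ≥ 1`. [folklore] -/
theorem _root_.Literature.NumberTheory.EllipticCurves.prime_pow_eq_two_mul_add_one (hp2 : p ≠ 2) (n : ℕ) :
    p ^ (n + 1) = 2 * ((p ^ (n + 1) - 1) / 2) + 1 ∧ 1 ≤ (p ^ (n + 1) - 1) / 2 := by
  have h := two_mul_div_add_three_eq_prime_pow p hp2 n
  omega

omit [W.IsCharNeTwoNF] in
/-- **At an ordinary prime all `w_{pⁿ⁺¹-1}` have norm one** (from `‖w_{p-1}‖ = 1`, via the integral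
model and `isUnit_coeff_formalInvDiff_prime_pow_sub_one`). [Blakestad–Grant 2023, Prop. 3(b),
Lemma 4] [folklore] -/
theorem norm_coeff_formalOmega_prime_pow_sub_one (hp2 : p ≠ 2) (hA : ‖coeff (p - 1) W.formalOmega‖ = 1)
    (n : ℕ) : ‖coeff (p ^ (n + 1) - 1) W.formalOmega‖ = 1 := by
  set V := W.integralModel ℤ_[p]
  set φ : ℤ_[p] →+* ℚ_[p] := PadicInt.Coe.ringHom
  have hVW : V.map φ = W := W.eq_map_integralModel
  have h1 : W.formalOmega = PowerSeries.map φ V.formalInvDiff := by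
    rw [V.map_formalInvDiff φ, hVW, W.formalInvDiff_eq_formalOmega]
  haveI := padicInt_isAdicComplete_span_p p
  have hAV : IsUnit (coeff (p - 1) V.formalInvDiff) := by
    rw [PadicInt.isUnit_iff]; rw [h1, coeff_map] at hA; exact_mod_cast hA
  have hwV := V.isUnit_coeff_formalInvDiff_prime_pow_sub_one p hp2 hAV n
  rw [h1, coeff_map]
  have := PadicInt.isUnit_iff.mp hwV
  exact_mod_cast this

/-- **`‖H_{pⁿ⁺¹}‖ = ‖[x^{pⁿ⁺¹-1}] f^{(pⁿ⁺¹-1)/2}‖ = 1` at an ordinary prime** (`= ‖w_{pⁿ⁺¹-1}‖`).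
[Blakestad–Grant 2023, Prop. 3(b) ("`H_n` is a unit in `R̂`")] [cite: BlakestadGrant2023, Prop. 3] -/
theorem norm_coeff_rhsCubic_pow_eq_one (hp2 : p ≠ 2) (hA : ‖coeff (p - 1) W.formalOmega‖ = 1) (n : ℕ) :
    ‖(W.rhsCubic ^ ((p ^ (n + 1) - 1) / 2)).coeff (p ^ (n + 1) - 1)‖ = 1 := by
  obtain ⟨hN, -⟩ := prime_pow_eq_two_mul_add_one hp2 n
  set m := (p ^ (n + 1) - 1) / 2 with hm
  have hidx : p ^ (n + 1) - 1 = 2 * m := by omega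
  have h := W.norm_coeff_formalOmega_prime_pow_sub_one hp2 hA n
  rw [hidx, ← W.formalInvDiff_eq_formalOmega, W.coeff_two_mul_formalInvDiff] at h
  rw [hidx]
  exact h

omit [W.IsIntegral ℤ_[p]] [W.IsCharNeTwoNF] in
/-- The norm of an odd prime power in `ℚ_p`. [folklore] -/
theorem _root_.Literature.NumberTheory.EllipticCurves.padic_norm_two_mul_add_one (hp2 : p ≠ 2) (n : ℕ) :
    ‖(2 * (((p ^ (n + 1) - 1) / 2 : ℕ) : ℚ_[p]) + 1)‖ = (p : ℝ) ^ (-(n + 1 : ℤ)) := by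
  obtain ⟨hN, -⟩ := prime_pow_eq_two_mul_add_one hp2 n
  have hcast : (2 * (((p ^ (n + 1) - 1) / 2 : ℕ) : ℚ_[p]) + 1) = ((p : ℚ_[p])) ^ (n + 1) := by
    have := congrArg (fun k : ℕ => (k : ℚ_[p])) hN
    push_cast at this
    exact this.symm
  rw [hcast, Padic.norm_p_pow]
  norm_cast

/-- **The Mazur–Tate constant modulo `pⁿ⁺¹`, explicitly.** At a prime `p ≥ 3` of good ORDINARY
reduction (`‖w_{p-1}‖ = 1`) of a `p`-integral model `y² = f(x) = x³ + a₂x² + a₄x + a₆` over `ℚ_p`, a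
Mazur–Tate sigma pair `(σ, c)` (`x + c = -D(Dσ/σ)`) satisfies, with `m = (pⁿ⁺¹ - 1)/2`,
**`‖c + [x^{pⁿ⁺¹-2}]f^m / [x^{pⁿ⁺¹-1}]f^m‖ ≤ p^{-(n+1)}`** — i.e. `c ≡ -J_n/H_n = -β_n (mod pⁿ⁺¹)`
with Blakestad–Grant's `β_n`, made explicit. [Blakestad–Grant 2023, Thm. 2 (proof), Prop. 3;
Mazur–Stein–Tate 2006, Thm. 1.3] [cite: BlakestadGrant2023, Thm. 2] -/
theorem IsMazurTateSigmaPair.norm_const_add_div_le (hp2 : p ≠ 2) {σ : ℚ_[p]⟦X⟧} {c : ℚ_[p]}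
    (h : W.IsMazurTateSigmaPair σ c) (hA : ‖coeff (p - 1) W.formalOmega‖ = 1) (n : ℕ) :
    ‖c + (W.rhsCubic ^ ((p ^ (n + 1) - 1) / 2)).coeff (p ^ (n + 1) - 2) /
        (W.rhsCubic ^ ((p ^ (n + 1) - 1) / 2)).coeff (p ^ (n + 1) - 1)‖ ≤ (p : ℝ) ^ (-(n + 1 : ℤ)) := by
  obtain ⟨hN, hm1⟩ := prime_pow_eq_two_mul_add_one hp2 n
  set m := (p ^ (n + 1) - 1) / 2 with hm
  set H := (W.rhsCubic ^ m).coeff (p ^ (n + 1) - 1) with hH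
  set J := (W.rhsCubic ^ m).coeff (p ^ (n + 1) - 2) with hJ
  have hHn : ‖H‖ = 1 := W.norm_coeff_rhsCubic_pow_eq_one hp2 hA n
  have hH0 : H ≠ 0 := fun h0 => by rw [h0, norm_zero] at hHn; exact zero_ne_one hHn
  have hw : ‖coeff (2 * m) W.formalOmega‖ = 1 := by
    have := W.norm_coeff_formalOmega_prime_pow_sub_one hp2 hA n
    rwa [hN, Nat.add_sub_cancel] at this
  have hmain := IsMazurTateSigmaPair.norm_const_mul_add_le W h hm1 hw
  rw [show 2 * m = p ^ (n + 1) - 1 by omega, show p ^ (n + 1) - 1 - 1 = p ^ (n + 1) - 2 by omega,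
    ← hH, ← hJ, padic_norm_two_mul_add_one hp2 n] at hmain
  have e : c + J / H = (c * H + J) / H := by field_simp
  rw [e, norm_div, hHn, div_one]
  exact hmain

/-- **The Mazur–Tate constant is the `p`-adic limit
`c = -lim_n [x^{pⁿ⁺¹-2}] f^{(pⁿ⁺¹-1)/2} / [x^{pⁿ⁺¹-1}] f^{(pⁿ⁺¹-1)/2}`** at a prime `p ≥ 3` of good
ordinary reduction (`‖w_{p-1}‖ = 1`) of a `p`-integral model `y² = f(x)` over `ℚ_p`, for any
Mazur–Tate sigma pair `(σ, c)` — Blakestad–Grant's `β = lim β_n` (`= -c`) with `β_n = J_n/H_n`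
made explicit: `H_n = [x^{pⁿ-1}] f^{(pⁿ-1)/2}`, `J_n = [x^{pⁿ-2}] f^{(pⁿ-1)/2}`. Consequently
`E₂(E, ω) = a₁² + 4a₂ - 12c` (Mazur–Stein–Tate 2006 (1.7)) is computed by the same limit.
[Blakestad–Grant 2023, Thm. 2 (proof: "`β_{n+1} ≡ β_n mod pⁿ`, so we can set `β = lim β_n`");
Mazur–Stein–Tate 2006, Thm. 1.3, (1.7)] [cite: BlakestadGrant2023, Thm. 2] -/
theorem IsMazurTateSigmaPair.tendsto_neg_coeff_div_coeff (hp2 : p ≠ 2) {σ : ℚ_[p]⟦X⟧} {c : ℚ_[p]}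
    (h : W.IsMazurTateSigmaPair σ c) (hA : ‖coeff (p - 1) W.formalOmega‖ = 1) :
    Tendsto (fun n : ℕ => -((W.rhsCubic ^ ((p ^ (n + 1) - 1) / 2)).coeff (p ^ (n + 1) - 2) /
        (W.rhsCubic ^ ((p ^ (n + 1) - 1) / 2)).coeff (p ^ (n + 1) - 1))) atTop (𝓝 c) := by
  have hp : p.Prime := Fact.out
  refine tendsto_iff_norm_sub_tendsto_zero.mpr ?_
  have hbound : ∀ n : ℕ, ‖-((W.rhsCubic ^ ((p ^ (n + 1) - 1) / 2)).coeff (p ^ (n + 1) - 2) /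
      (W.rhsCubic ^ ((p ^ (n + 1) - 1) / 2)).coeff (p ^ (n + 1) - 1)) - c‖ ≤ (p : ℝ) ^ (-(n + 1 : ℤ)) :=
    fun n => by
      rw [← norm_neg, neg_sub, sub_neg_eq_add]
      exact IsMazurTateSigmaPair.norm_const_add_div_le W hp2 h hA n
  have hlim : Tendsto (fun n : ℕ => (p : ℝ) ^ (-(n + 1 : ℤ))) atTop (𝓝 0) := by
    have hp1 : (1 : ℝ) < p := by exact_mod_cast hp.one_lt
    have : (fun n : ℕ => (p : ℝ) ^ (-(n + 1 : ℤ))) = fun n : ℕ => ((p : ℝ)⁻¹) ^ (n + 1) := by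
      funext n
      rw [zpow_neg, ← inv_zpow]
      norm_cast
    rw [this]
    exact (tendsto_pow_atTop_nhds_zero_of_lt_one (inv_nonneg.mpr (by positivity))
      (inv_lt_one_of_one_lt₀ hp1)).comp (tendsto_add_atTop_nat 1)
  exact squeeze_zero (fun n => norm_nonneg _) hbound hlim

end Padic

end WeierstrassCurve
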